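import Summits.BirchSwinnertonDyer.BirchSwinnertonDyer.Theorems.EisensteinDepletionAtTwoStarGO2LoopParityLemmas
import HarnessLib

/-!
# The loop parity of a NON-odd rational `2`-torsion point: largest root ↔ minus symbol, middle root ↔
# plus + minus — stub `stub_loopParityNonOdd` of line `parities` on crux `StarGO2`
# (item stmt-BirchSwinnertonDyer-24444, route `EisensteinDepletionAtTwo`), body BY NAME after `unfold LoopEven TwoTorsionLargest`

Twin, on the minus side, of `star_plusOddClass` (eng-2 GEN 11): for the optimal model `(W₀, L₀ = q·Λ_f)` of the class of a newform
`f` of `W` and a rational `2`-torsion abscissa `x₀` of `W₀` which is NOT the least real root, the lattice is rectangular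
(`Λ₀ = ℤΩ₀ ⊕ ℤ·iΩ₀'`, three real roots) and

* if `x₀` is the LARGEST root then `x₀ + b₂/12 = ℘(Ω₀/2)` and, with `λ = Ω₀` (the real period), the loop `{0 → b/d}` pairs evenly with
  `λ/2` iff the minus symbol `2([b/d]⁻ − [0]⁻) = n⁻` is even (`star_loopParity_real`: `im Λ_f = ℤΩ⁻/2`, real lattice points are
  the multiples of `Ω₀`);
* otherwise `x₀` is the MIDDLE root, `x₀ + b₂/12 = ℘((Ω₀ + iΩ₀')/2)` (three distinct real roots ⇒ `disc > 0` ⇒ rectangular,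
  `IsReal.half_sum_notMem_of_discr_pos`; the third half-period value is the remaining root, `cubic_eq_prod_of_roots`), and with
  `λ = Ω₀ + iΩ₀'` the loop parity is that of `n⁺ + n⁻` (`parityLattice_sum_iff`: in `Λ₀/2Λ₀ ≅ 𝔽₂²` the class of `Ω₀ + iΩ₀'` is
  the third nonzero class, so `z ∈ ℤλ + 2Λ₀ ⟺ (z ∈ ℤΩ₀ + 2Λ₀ ⟺ z ∈ ℤiΩ₀' + 2Λ₀)`, and the two sides are the minus and plus parities
  `star_loopParity_real`, `star_loopParity_imag`).

The final theorem `star_loopParityNonOdd` is the registered stub with the skeleton's local abbreviations `LoopEven`,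
`TwoTorsionLargest` unfolded (closer in `parities.lean`: `unfold LoopEven TwoTorsionLargest; exact DepletionAtTwo.star_loopParityNonOdd`).

HONEST FRAMING: real-lattice bookkeeping for the skeleton of an OPEN crux; `StarGO2` is not proved by it; nothing reads an analytic
rank; BSD is not proved by any of this.

References: D. F. Lawden, *Elliptic Functions and Applications* (1989), §§6.11, 6.15–6.16 [Lawden1989]; J. E. Cremona, *Algorithms for
Modular Elliptic Curves* (1997), §2.8, §2.10 [CremonaAlgorithms1997]; B. Mazur, J. Tate, J. Teitelbaum, Invent. Math. 84 (1986), §I.8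
[MazurTateTeitelbaum1986Invent].
-/

set_option linter.dupNamespace false
set_option autoImplicit false

noncomputable section

open scoped MatrixGroups ModularForm ComplexConjugate PeriodPair

open Complex CongruenceSubgroup Literature.NumberTheory.EllipticCurves Literature.NumberTheory.EllipticCurves.ModularForms
  Literature.NumberTheory.EllipticCurves.Greenberg1999

namespace Summit.BirchSwinnertonDyer.BirchSwinnertonDyer.Theorems.DepletionAtTwo

/-! ### §4. The theorem: the registered stub with `LoopEven` / `TwoTorsionLargest` unfolded -/

section Main

/-- `iΩ₀' ∈ Λ` for a real lattice `Λ` (`Ω₀'` the least positive real period of `iΛ`). [folklore] -/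
theorem I_mul_minRealPeriod_mulLeft_mem {L : PeriodPair} (h : L.IsReal) :
    I * ((L.mulLeft I I_ne_zero).minRealPeriod : ℂ) ∈ L.lattice := by
  have h1 := h.mulLeft_I.minRealPeriod_mem_lattice
  rw [PeriodPair.mem_mulLeft_lattice, Complex.inv_I, neg_mul] at h1
  simpa using neg_mem h1

/-- The invariants of a Néron pair of a curve over `ℚ` are real: `g₂ = re g₂`, `g₃ = re g₃`. [cite: SilvermanAEC2009, VI.5.1] -/
theorem g₂_g₃_eq_ofReal_of_isNeronLatticeOf_baseChange (W₀ : WeierstrassCurve ℚ) {L₀ : PeriodPair}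
    (hL : IsNeronLatticeOf (W₀.baseChange ℂ) L₀) :
    L₀.g₂ = ((L₀.g₂.re : ℝ) : ℂ) ∧ L₀.g₃ = ((L₀.g₃.re : ℝ) : ℂ) := by
  have h2 : L₀.g₂.im = 0 := by
    rw [hL.1, WeierstrassCurve.baseChange, WeierstrassCurve.map_c₄, eq_ratCast, ← Complex.ofReal_ratCast,
      show ((12 : ℂ)) = ((12 : ℝ) : ℂ) by norm_num, ← Complex.ofReal_div, Complex.ofReal_im]
  have h3 : L₀.g₃.im = 0 := by
    rw [hL.2, WeierstrassCurve.baseChange, WeierstrassCurve.map_c₆, eq_ratCast, ← Complex.ofReal_ratCast,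
      show ((216 : ℂ)) = ((216 : ℝ) : ℂ) by norm_num, ← Complex.ofReal_div, Complex.ofReal_im]
  exact ⟨Complex.ext (by simp) (by simp [h2]), Complex.ext (by simp) (by simp [h3])⟩

/-- **The body of the registered stub `stub_loopParityNonOdd` of line `parities` (crux `StarGO2`, stmt-BirchSwinnertonDyer-24444)**,
with the skeleton's `LoopEven f q L₀ λ b d` (`∃ k, ∃ w ∈ Λ₀, q·({∞,b/d}_f − {∞,0}_f) = kλ + 2w`) and `TwoTorsionLargest W₀ x₀` (every real
root of the `2`-division cubic is `≤ x₀`) UNFOLDED: for a rational `2`-torsion abscissa `x₀` of the optimal model which is NOT the least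
root there is a half-lattice vector `λ` over `x₀` — the real period `Ω₀` if `x₀` is the largest root, `Ω₀ + iΩ₀'` if it is the middle one —
whose loop parity on the cusps `b/d` (`d > 0`, `gcd(d, bN_W) = 1`) is the parity of `n⁻` resp. `n⁺ + n⁻`. Closer in the skeleton:
`unfold LoopEven TwoTorsionLargest; exact DepletionAtTwo.star_loopParityNonOdd`. [cite: Lawden1989, §§6.11–6.16]
[cite: CremonaAlgorithms1997, §2.8, §2.10] [cite: MazurTateTeitelbaum1986Invent, §I.8] -/
theorem star_loopParityNonOdd :
    ∀ (W : WeierstrassCurve ℚ) [W.IsElliptic] [W.IsGloballyMinimal] (W₀ : WeierstrassCurve ℚ) [W₀.IsElliptic]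
      [W₀.IsGloballyMinimal] ⦃N : ℕ⦄ [NeZero N] (f : CuspForm (Gamma0 N) 2), IsNewformOf W f → IsNewformOf W₀ f →
      ∀ (L₀ : PeriodPair), IsNeronLatticeOf (W₀.baseChange ℂ) L₀ → ∀ (q : ℚ), q ≠ 0 →
        (∀ z ∈ periodLattice f, (q : ℂ) * z ∈ L₀.lattice) → (∀ z ∈ L₀.lattice, ∃ w ∈ periodLattice f, z = (q : ℂ) * w) →
      ∀ (x₀ : ℚ), HasRationalTwoTorsionX W₀ x₀ → ¬ TwoTorsionOdd W₀ x₀ →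
        ∃ lam : ℂ, lam ∈ L₀.lattice ∧ lam / 2 ∉ L₀.lattice ∧
          L₀.weierstrassP (lam / 2) - ((W₀.b₂ : ℚ) : ℂ) / 12 = ((x₀ : ℚ) : ℂ) ∧
          ∀ b d : ℤ, 0 < d → Int.gcd d (b * (W.conductorNorm ℤ : ℕ)) = 1 →
            ∃ np nm : ℤ, ratPlusSymbol f ((b : ℚ) / (d : ℚ)) - ratPlusSymbol f 0 = np * (1 / 2 : ℚ) ∧
              ratMinusSymbol f ((b : ℚ) / (d : ℚ)) - ratMinusSymbol f 0 = nm * (1 / 2 : ℚ) ∧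
              ((∀ r : ℝ, 4 * r ^ 3 + (W₀.b₂ : ℝ) * r ^ 2 + 2 * (W₀.b₄ : ℝ) * r + (W₀.b₆ : ℝ) = 0 → r ≤ (x₀ : ℝ)) →
                ((∃ k : ℤ, ∃ w ∈ L₀.lattice,
                    (q : ℂ) * (modularSymbol f ((b : ℚ) / (d : ℚ)) - modularSymbol f 0) = (k : ℂ) * lam + 2 * w) ↔ Even nm)) ∧
              (¬ (∀ r : ℝ, 4 * r ^ 3 + (W₀.b₂ : ℝ) * r ^ 2 + 2 * (W₀.b₄ : ℝ) * r + (W₀.b₆ : ℝ) = 0 → r ≤ (x₀ : ℝ)) →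
                ((∃ k : ℤ, ∃ w ∈ L₀.lattice,
                    (q : ℂ) * (modularSymbol f ((b : ℚ) / (d : ℚ)) - modularSymbol f 0) = (k : ℂ) * lam + 2 * w) ↔
                  Even (np + nm))) := by
  intro W _ _ W₀ _ _ N _ f hfW hf₀ L₀ hL q hq hsub hsup x₀ hx hnodd
  have hreal : L₀.IsReal := isReal_of_isNeronLatticeOf_baseChange W₀ hL
  obtain ⟨hA, hB⟩ := g₂_re_g₃_re_of_isNeronLatticeOf_baseChange W₀ hL
  obtain ⟨hg₂, hg₃⟩ := g₂_g₃_eq_ofReal_of_isNeronLatticeOf_baseChange W₀ hL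
  obtain ⟨y, hxy, h2y⟩ := hx
  -- abbreviations (plain `have`-free names)
  have hΩpos : 0 < L₀.minRealPeriod := hreal.minRealPeriod_pos
  -- the shift between the `2`-division cubic and `f(x) = 4x³ − g₂x − g₃`
  have shift : ∀ r : ℝ, 4 * r ^ 3 + (W₀.b₂ : ℝ) * r ^ 2 + 2 * (W₀.b₄ : ℝ) * r + (W₀.b₆ : ℝ) =
      4 * (r + (W₀.b₂ : ℝ) / 12) ^ 3 - L₀.g₂.re * (r + (W₀.b₂ : ℝ) / 12) - L₀.g₃.re := by
    intro r; rw [hA, hB, cubic_shift]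
  -- `X = x₀ + b₂/12` is a root of `f`
  have hrootX : 4 * ((x₀ : ℝ) + (W₀.b₂ : ℝ) / 12) ^ 3 - L₀.g₂.re * ((x₀ : ℝ) + (W₀.b₂ : ℝ) / 12) - L₀.g₃.re = 0 := by
    rw [← shift]; exact fourXCubed_add_eq_zero_of_twoTorsion_real hxy h2y
  -- `e₁ = ℘(Ω₀/2)` is the largest root, `e' = ℘(iΩ₀'/2)` the least
  have he₁root := hreal.cubic_weierstrassPRe_half
  have hle_e₁ : ∀ x : ℝ, 4 * x ^ 3 - L₀.g₂.re * x - L₀.g₃.re = 0 → x ≤ L₀.weierstrassPRe (L₀.minRealPeriod / 2) :=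
    fun x hx ↦ not_lt.mp fun hlt ↦ (hreal.cubic_pos_of_lt hlt).ne' hx
  have he'root := cubic_halfPeriodI_eq_zero hreal
  have hge_e' : ∀ x : ℝ, 4 * x ^ 3 - L₀.g₂.re * x - L₀.g₃.re = 0 →
      -(L₀.mulLeft I I_ne_zero).weierstrassPRe ((L₀.mulLeft I I_ne_zero).minRealPeriod / 2) ≤ x :=
    fun x hx ↦ halfPeriodI_le_of_root hreal hx
  -- from `¬ odd`: a root `r₂ < x₀`
  obtain ⟨r₂, hr₂, hr₂lt⟩ : ∃ r : ℝ, 4 * r ^ 3 + (W₀.b₂ : ℝ) * r ^ 2 + 2 * (W₀.b₄ : ℝ) * r + (W₀.b₆ : ℝ) = 0 ∧ r < (x₀ : ℝ) := by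
    simp only [TwoTorsionOdd, not_forall, not_le, exists_prop] at hnodd
    exact hnodd
  rw [shift] at hr₂
  by_cases hlarge : ∀ r : ℝ, 4 * r ^ 3 + (W₀.b₂ : ℝ) * r ^ 2 + 2 * (W₀.b₄ : ℝ) * r + (W₀.b₆ : ℝ) = 0 → r ≤ (x₀ : ℝ)
  · /- LARGEST root: `λ = Ω₀` (the real period), `x₀ + b₂/12 = ℘(Ω₀/2)` -/
    have hXe₁ : (x₀ : ℝ) + (W₀.b₂ : ℝ) / 12 = L₀.weierstrassPRe (L₀.minRealPeriod / 2) := by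
      refine le_antisymm (hle_e₁ _ hrootX) ?_
      have h := hlarge (L₀.weierstrassPRe (L₀.minRealPeriod / 2) - (W₀.b₂ : ℝ) / 12) (by
        rw [shift, sub_add_cancel]; exact he₁root)
      linarith
    refine ⟨(L₀.minRealPeriod : ℂ), hreal.minRealPeriod_mem_lattice, hreal.minRealPeriod_div_two_notMem, ?_, ?_⟩
    · have h1 : L₀.weierstrassP ((L₀.minRealPeriod : ℂ) / 2) = ((L₀.weierstrassPRe (L₀.minRealPeriod / 2) : ℝ) : ℂ) := by
        rw [hreal.ofReal_weierstrassPRe]; push_cast; ring_nf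
      rw [h1, ← hXe₁]
      push_cast
      ring
    · intro b d _ hcop
      obtain ⟨hpos, hre, hmpos, him, hmem, np, nm, hnp, hnm, hure, huim⟩ := exists_plus_minus_symbol_data W f hfW hcop
      exact ⟨np, nm, hnp, hnm, fun _ ↦ star_loopParity_real f hreal hq hsub hsup him hmpos hmem huim,
        fun h ↦ absurd hlarge h⟩
  · /- MIDDLE root: `λ = Ω₀ + iΩ₀'` -/
    obtain ⟨r₁, hr₁, hr₁gt⟩ : ∃ r : ℝ, 4 * r ^ 3 + (W₀.b₂ : ℝ) * r ^ 2 + 2 * (W₀.b₄ : ℝ) * r + (W₀.b₆ : ℝ) = 0 ∧ (x₀ : ℝ) < r := by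
      simp only [not_forall, not_le, exists_prop] at hlarge
      exact hlarge
    rw [shift] at hr₁
    -- three distinct real roots ⇒ `disc > 0` ⇒ rectangular
    have hdisc : 0 < L₀.g₂.re ^ 3 - 27 * L₀.g₃.re ^ 2 :=
      PeriodPair.cubic_discr_pos_of_roots (a := r₂ + (W₀.b₂ : ℝ) / 12) (b := (x₀ : ℝ) + (W₀.b₂ : ℝ) / 12)
        (c := r₁ + (W₀.b₂ : ℝ) / 12) (by intro h; linarith) (by intro h; linarith) (by intro h; linarith) hr₂ hrootX hr₁
    have hrect : ((L₀.minRealPeriod : ℂ) + I * (L₀.mulLeft I I_ne_zero).minRealPeriod) / 2 ∉ L₀.lattice :=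
      hreal.half_sum_notMem_of_discr_pos hdisc
    have hIΩ' : I * ((L₀.mulLeft I I_ne_zero).minRealPeriod : ℂ) ∈ L₀.lattice := I_mul_minRealPeriod_mulLeft_mem hreal
    have hlam_mem : (L₀.minRealPeriod : ℂ) + I * (L₀.mulLeft I I_ne_zero).minRealPeriod ∈ L₀.lattice :=
      add_mem hreal.minRealPeriod_mem_lattice hIΩ'
    have h2p : 2 * (((L₀.minRealPeriod : ℂ) + I * (L₀.mulLeft I I_ne_zero).minRealPeriod) / 2) ∈ L₀.lattice := by
      rw [mul_div_cancel₀ _ (two_ne_zero' ℂ)]; exact hlam_mem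
    -- `℘(p)` is real, `p = (Ω₀ + iΩ₀')/2`
    have hconj : conj (((L₀.minRealPeriod : ℂ) + I * (L₀.mulLeft I I_ne_zero).minRealPeriod) / 2) =
        ((L₀.minRealPeriod : ℂ) + I * (L₀.mulLeft I I_ne_zero).minRealPeriod) / 2 -
          ((⟨I * ((L₀.mulLeft I I_ne_zero).minRealPeriod : ℂ), hIΩ'⟩ : L₀.lattice) : ℂ) := by
      simp only [map_div₀, map_add, map_mul, Complex.conj_ofReal, Complex.conj_I, map_ofNat]
      ring
    have hPim : (L₀.weierstrassP (((L₀.minRealPeriod : ℂ) + I * (L₀.mulLeft I I_ne_zero).minRealPeriod) / 2)).im = 0 := by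
      have h1 := hreal.weierstrassP_conj (((L₀.minRealPeriod : ℂ) + I * (L₀.mulLeft I I_ne_zero).minRealPeriod) / 2)
      rw [hconj, L₀.weierstrassP_sub_coe] at h1
      have h2 := congr_arg Complex.im h1
      rw [Complex.conj_im] at h2
      linarith
    have hPe : L₀.weierstrassP (((L₀.minRealPeriod : ℂ) + I * (L₀.mulLeft I I_ne_zero).minRealPeriod) / 2) =
        (((L₀.weierstrassP (((L₀.minRealPeriod : ℂ) + I * (L₀.mulLeft I I_ne_zero).minRealPeriod) / 2)).re : ℝ) : ℂ) :=
      Complex.ext (by simp) (by simp [hPim])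
    -- `e'' = re ℘(p)` is a root of `f`
    have he''root : 4 * (L₀.weierstrassP (((L₀.minRealPeriod : ℂ) + I * (L₀.mulLeft I I_ne_zero).minRealPeriod) / 2)).re ^ 3 -
        L₀.g₂.re * (L₀.weierstrassP (((L₀.minRealPeriod : ℂ) + I * (L₀.mulLeft I I_ne_zero).minRealPeriod) / 2)).re -
          L₀.g₃.re = 0 := by
      have hc := cubic_weierstrassP_eq_zero_of_two_mul_mem L₀ hrect h2p
      rw [hPe, hg₂, hg₃] at hc
      exact_mod_cast hc
    -- `e'' ≠ e₁`, `e'' ≠ e'`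
    have hΩ2 : L₀.minRealPeriod / 2 ∉ {t : ℝ | (t : ℂ) ∈ L₀.lattice} := by
      intro h; exact hreal.minRealPeriod_div_two_notMem (by simpa using h)
    have hne1 : (L₀.weierstrassP (((L₀.minRealPeriod : ℂ) + I * (L₀.mulLeft I I_ne_zero).minRealPeriod) / 2)).re ≠
        L₀.weierstrassPRe (L₀.minRealPeriod / 2) := by
      intro h
      have hΩhalf : ((L₀.minRealPeriod / 2 : ℝ) : ℂ) ∉ L₀.lattice := by
        have := hreal.minRealPeriod_div_two_notMem; push_cast; exact this
      have heq : L₀.weierstrassP (((L₀.minRealPeriod : ℂ) + I * (L₀.mulLeft I I_ne_zero).minRealPeriod) / 2) =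
          L₀.weierstrassP ((L₀.minRealPeriod / 2 : ℝ) : ℂ) := by
        rw [hPe, h, hreal.ofReal_weierstrassPRe]
      rcases (L₀.weierstrassP_eq_weierstrassP_iff hrect hΩhalf).mp heq with h' | h'
      · -- `p + Ω₀/2 = Ω₀ + iΩ₀'/2 ∈ Λ ⇒ iΩ₀'/2 ∈ Λ`
        apply hreal.I_mul_minRealPeriod_div_two_notMem
        have : I * ((L₀.mulLeft I I_ne_zero).minRealPeriod : ℂ) / 2 =
            (((L₀.minRealPeriod : ℂ) + I * (L₀.mulLeft I I_ne_zero).minRealPeriod) / 2 + ((L₀.minRealPeriod / 2 : ℝ) : ℂ)) -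
              (L₀.minRealPeriod : ℂ) := by push_cast; ring
        rw [this]
        exact sub_mem h' hreal.minRealPeriod_mem_lattice
      · -- `p − Ω₀/2 = iΩ₀'/2 ∈ Λ`
        apply hreal.I_mul_minRealPeriod_div_two_notMem
        have : I * ((L₀.mulLeft I I_ne_zero).minRealPeriod : ℂ) / 2 =
            ((L₀.minRealPeriod : ℂ) + I * (L₀.mulLeft I I_ne_zero).minRealPeriod) / 2 - ((L₀.minRealPeriod / 2 : ℝ) : ℂ) := by
          push_cast; ring
        rw [this]
        exact h'
    have hne2 : (L₀.weierstrassP (((L₀.minRealPeriod : ℂ) + I * (L₀.mulLeft I I_ne_zero).minRealPeriod) / 2)).re ≠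
        -(L₀.mulLeft I I_ne_zero).weierstrassPRe ((L₀.mulLeft I I_ne_zero).minRealPeriod / 2) := by
      intro h
      obtain ⟨-, hw_not, -⟩ := hreal.two_mul_halfPeriodI_mem
      have heq : L₀.weierstrassP (((L₀.minRealPeriod : ℂ) + I * (L₀.mulLeft I I_ne_zero).minRealPeriod) / 2) =
          L₀.weierstrassP (I * ((((L₀.mulLeft I I_ne_zero).minRealPeriod / 2 : ℝ)) : ℂ)) := by
        rw [hPe, h, weierstrassP_halfPeriodI_eq hreal]
      rcases (L₀.weierstrassP_eq_weierstrassP_iff hrect hw_not).mp heq with h' | h'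
      · -- `p + iΩ₀'/2 = Ω₀/2 + iΩ₀' ∈ Λ ⇒ Ω₀/2 ∈ Λ`
        apply hreal.minRealPeriod_div_two_notMem
        have : (L₀.minRealPeriod : ℂ) / 2 =
            (((L₀.minRealPeriod : ℂ) + I * (L₀.mulLeft I I_ne_zero).minRealPeriod) / 2 +
              I * ((((L₀.mulLeft I I_ne_zero).minRealPeriod / 2 : ℝ)) : ℂ)) - I * ((L₀.mulLeft I I_ne_zero).minRealPeriod : ℂ) := by
          push_cast; ring
        rw [this]
        exact sub_mem h' hIΩ'
      · apply hreal.minRealPeriod_div_two_notMem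
        have : (L₀.minRealPeriod : ℂ) / 2 =
            ((L₀.minRealPeriod : ℂ) + I * (L₀.mulLeft I I_ne_zero).minRealPeriod) / 2 -
              I * ((((L₀.mulLeft I I_ne_zero).minRealPeriod / 2 : ℝ)) : ℂ) := by
          push_cast; ring
        rw [this]
        exact h'
    -- order: `e' ≤ R₂ < X < R₁ ≤ e₁`
    have hR₁le : r₁ + (W₀.b₂ : ℝ) / 12 ≤ L₀.weierstrassPRe (L₀.minRealPeriod / 2) := hle_e₁ _ hr₁
    have hR₂ge : -(L₀.mulLeft I I_ne_zero).weierstrassPRe ((L₀.mulLeft I I_ne_zero).minRealPeriod / 2) ≤ r₂ + (W₀.b₂ : ℝ) / 12 :=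
      hge_e' _ hr₂
    have hne12 : L₀.weierstrassPRe (L₀.minRealPeriod / 2) ≠
        -(L₀.mulLeft I I_ne_zero).weierstrassPRe ((L₀.mulLeft I I_ne_zero).minRealPeriod / 2) := by
      intro h; linarith
    -- `X` is one of the three half-period values, not `e₁`, not `e'`: it is `e''`
    have hfac := PeriodPair.cubic_eq_prod_of_roots hne12 hne1.symm hne2.symm he₁root he'root he''root
      ((x₀ : ℝ) + (W₀.b₂ : ℝ) / 12)
    rw [hrootX] at hfac
    have hXe'' : (x₀ : ℝ) + (W₀.b₂ : ℝ) / 12 =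
        (L₀.weierstrassP (((L₀.minRealPeriod : ℂ) + I * (L₀.mulLeft I I_ne_zero).minRealPeriod) / 2)).re := by
      have h0 := hfac.symm
      rcases mul_eq_zero.mp h0 with h01 | h3
      · rcases mul_eq_zero.mp h01 with h02 | h2
        · rcases mul_eq_zero.mp h02 with h4 | h1
          · norm_num at h4
          · exfalso; have := sub_eq_zero.mp h1; linarith
        · exfalso; have := sub_eq_zero.mp h2; linarith
      · exact sub_eq_zero.mp h3
    refine ⟨(L₀.minRealPeriod : ℂ) + I * (L₀.mulLeft I I_ne_zero).minRealPeriod, hlam_mem, hrect, ?_, ?_⟩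
    · rw [hPe, ← hXe'']
      push_cast
      ring
    · intro b d _ hcop
      obtain ⟨hpos, hre, hmpos, him, hmem, np, nm, hnp, hnm, hure, huim⟩ := exists_plus_minus_symbol_data W f hfW hcop
      refine ⟨np, nm, hnp, hnm, fun h ↦ absurd h hlarge, fun _ ↦ ?_⟩
      rw [parityLattice_sum_iff hreal hrect (hsub _ hmem), star_loopParity_real f hreal hq hsub hsup him hmpos hmem huim,
        star_loopParity_imag f hreal hq hsub hsup hre hpos hmem hure, Int.even_add]
      exact iff_comm

end Main

end Summit.BirchSwinnertonDyer.BirchSwinnertonDyer.Theorems.DepletionAtTwo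

end
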